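import Summits.BirchSwinnertonDyer.BirchSwinnertonDyer.Theorems.GenusKolyvaginAtTwoGenusPrimitiveSupplyAtTwoGenusField

/-!
# Route `GenusKolyvaginAtTwo`, crux `GenusPrimitiveSupplyAtTwo` (stmt-BirchSwinnertonDyer-22136), line `genus-supply`:
# the GENUS-CHARACTER Heegner point `Y_χ = Σ_{g ∈ Gal(K[ℓ]/K)} χ_ℓ(g) g·y(ℓ)` is `χ_ℓ`-ISOTYPIC, and `2·Y_θ = a_ℓ·y_K + Y_χ`

Lead prover seat bsd-line-gk2-p1 (g2). Intrinsic form of the route's mechanism «`2 D_ℓ ≡ Tr − Y_χ`» at a Kolyvagin prime at `2`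
(cf. `…GenusIdentity` §4 / `…GenusField` §4, there in the `σ_ℓ`-language of the datum). With `θ = √ℓ* ∈ K[ℓ]`, the two cosets
`T⁺ = {g ∈ 𝒢_ℓ : gθ = θ} = Gal(K[ℓ]/K(√ℓ*))` and `T⁻ = {g ∈ 𝒢_ℓ : gθ = −θ}` of the genus character `χ_ℓ` of conductor `ℓ`
partition `𝒢_ℓ = Gal(K[ℓ]/K)`, and for `Y^± := Σ_{g∈T^±} g·y(ℓ)` (so `Y⁺ = Y_θ = Tr_{K[ℓ]/K(√ℓ*)} y(ℓ)`, the genus trace of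
`heegner_exists_two_zsmul_eq_derivedPoint_iff_genusTrace`):
* §1 `Y⁺ + Y⁻ = Tr_{K[ℓ]/K} y(ℓ) = a_ℓ · y_K′` (Gross Prop. 3.7 (1); `y_K′ = Σ_{s∈S} s y₁` is `y_K` read in `E(K[ℓ])`);
* §2 ISOTYPY: an element of `𝒢_ℓ` moving `θ` SWAPS `Y⁺` and `Y⁻`, one fixing `θ` fixes both; hence the genus-character point
  `Y_χ := Y⁺ − Y⁻` satisfies `h·Y_χ = χ_ℓ(h)·Y_χ` — it lies in the `χ_ℓ`-isotypic part `E(K[ℓ])^{χ_ℓ} ⊆ E(K(√ℓ*))^{−}`, the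
  Mordell–Weil group of the TWIST `E^{(ℓ*)}` over `K` (up to the twist isomorphism), i.e. the Gross–Zagier/Zhang datum of the genus
  pair `(E^{(ℓ*)}, E^{(d_K ℓ*)})`;
* §3 `2·Y⁺ = a_ℓ·y_K′ + Y_χ`, so with `…GenusField`: `P(ℓ) ∈ 2E(K[ℓ]) ⟺ Y⁺ ∈ 2E(K[ℓ])`, and when `a_ℓ·y_K′ ∈ 4E(K[ℓ])` (e.g.
  `4 ∣ a_ℓ`, or `y_K ∈ 2E`): `⟺ Y_χ ∈ 4E(K[ℓ])` — Kolyvagin `2`-primitivity at `ℓ` is a statement about the `χ_ℓ`-isotypic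
  genus point alone.
Helper (`--supports stmt-BirchSwinnertonDyer-22136`). No summit and no leaf is proved by this file; BSD is not proved by any of this.
-/

set_option linter.dupNamespace false -- tree convention: `Summit.BirchSwinnertonDyer.BirchSwinnertonDyer.Theorems` (summit = sub-problem)

noncomputable section

open scoped Classical

namespace Summit.BirchSwinnertonDyer.BirchSwinnertonDyer.Theorems.GenusKoly

open Finset NumberField WeierstrassCurve Literature.NumberTheory.EllipticCurves
  Literature.NumberTheory.EllipticCurves.ModularForms

section Heegner

variable {W : WeierstrassCurve ℚ} [NeZero (W.conductorNorm ℤ)] {K : Type} [Field K] [NumberField K]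
  {Dt : ModularParametrizationData W (W.conductorNorm ℤ)} {β : ℤ} {ι : K →+* ℂ}

/-! ## §1 The two cosets of the genus character partition `𝒢_ℓ`; the full trace -/

/-- **`T⁺ ⊔ T⁻ = 𝒢_ℓ` as the image of `S × [0, ℓ]`**: every `g ∈ Gal(K[ℓ]/K)` moves `θ` to `±θ` (`θ² ∈ ℚ`), and
`𝒢_ℓ = {s σ_ℓ^i}` (`heegner_mem_image_mul_pow_iff`). [cite: GrossLMS1991, §3–§4 (S, 𝒢_ℓ)] [cite: SilvermanAEC2009, X.2 Prop. 2.4 (proof)] -/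
theorem heegner_fixCoset_union_flipCoset_eq (hK : IsImaginaryQuadratic K) (hD : NumberField.discr K < -4) {ℓ : ℕ}
    (hℓ : ℓ.Prime) (hinert : (Ideal.span {(ℓ : 𝓞 K)}).IsPrime) (d : KolyvaginHeegnerData Dt β ι ℓ)
    {θ : ringClassField K ι ℓ} {q : ℚ} (hθ2 : θ ^ 2 = algebraMap ℚ (ringClassField K ι ℓ) q)
    (Tp Tm : Finset (ringClassField K ι ℓ ≃ₐ[ℚ] ringClassField K ι ℓ))
    (hTp : ∀ g, g ∈ Tp ↔ g ∈ ringClassGal ι ℓ ∧ g θ = θ) (hTm : ∀ g, g ∈ Tm ↔ g ∈ ringClassGal ι ℓ ∧ g θ = -θ) :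
    Tp ∪ Tm = (d.S ×ˢ range (ℓ + 1)).image
      (fun p : (ringClassField K ι ℓ ≃ₐ[ℚ] ringClassField K ι ℓ) × ℕ ↦ p.1 * d.σ ℓ ^ p.2) := by
  ext g
  rw [Finset.mem_union, hTp, hTm, heegner_mem_image_mul_pow_iff hK hD hℓ hinert d]
  constructor
  · rintro (⟨h, -⟩ | ⟨h, -⟩) <;> exact h
  · intro hg
    rcases algEquiv_apply_eq_or_eq_neg_of_sq_eq hθ2 g with h | h
    · exact Or.inl ⟨hg, h⟩
    · exact Or.inr ⟨hg, h⟩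

/-- `T⁺` and `T⁻` are disjoint (`θ ≠ −θ`). [folklore] -/
theorem heegner_disjoint_fixCoset_flipCoset {ℓ : ℕ} {θ : ringClassField K ι ℓ} (hθ0 : θ ≠ 0)
    (Tp Tm : Finset (ringClassField K ι ℓ ≃ₐ[ℚ] ringClassField K ι ℓ))
    (hTp : ∀ g, g ∈ Tp ↔ g ∈ ringClassGal ι ℓ ∧ g θ = θ) (hTm : ∀ g, g ∈ Tm ↔ g ∈ ringClassGal ι ℓ ∧ g θ = -θ) :
    Disjoint Tp Tm := by
  rw [Finset.disjoint_left]
  intro g hg hg'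
  rw [hTp] at hg
  rw [hTm] at hg'
  exact ne_neg_of_ne_zero hθ0 (hg.2.symm.trans hg'.2)

/-- **`Y⁺ + Y⁻ = Tr_{K[ℓ]/K} y(ℓ) = a_ℓ · y_K′`** (Gross 1991 Prop. 3.7 (1) «`Tr_ℓ y_ℓ = a_ℓ y_1`» summed over the representatives
`S`; `y_K′ = Σ_{s∈S} s y₁` with `y₁ ∈ E(K[ℓ])` over `x(1)`): for `K` imaginary quadratic with the Heegner hypothesis and `d_K < −4`,
`ℓ ∤ N_E` a prime inert in `K`, a datum `d` of conductor `ℓ`, and `θ ∈ K[ℓ]`, `θ² ∈ ℚ`, `θ ≠ 0`.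
[cite: GrossLMS1991, §3 Prop. 3.7 (1), §4 (4.1)] -/
theorem heegner_fixPart_add_flipPart_eq [W.IsElliptic] [W.IsGloballyMinimal] (hK : IsImaginaryQuadratic K)
    (hD : NumberField.discr K < -4) (hH : SatisfiesHeegnerHypothesis (W.conductorNorm ℤ) K) {ℓ : ℕ} (hℓ : ℓ.Prime)
    (hinert : (Ideal.span {(ℓ : 𝓞 K)}).IsPrime) (hℓN : ¬ ℓ ∣ W.conductorNorm ℤ) (d : KolyvaginHeegnerData Dt β ι ℓ)
    {θ : ringClassField K ι ℓ} {q : ℚ} (hθ2 : θ ^ 2 = algebraMap ℚ (ringClassField K ι ℓ) q) (hθ0 : θ ≠ 0)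
    (Tp Tm : Finset (ringClassField K ι ℓ ≃ₐ[ℚ] ringClassField K ι ℓ))
    (hTp : ∀ g, g ∈ Tp ↔ g ∈ ringClassGal ι ℓ ∧ g θ = θ) (hTm : ∀ g, g ∈ Tm ↔ g ∈ ringClassGal ι ℓ ∧ g θ = -θ) :
    ∃ y₁ : (W.baseChange (ringClassField K ι ℓ)).toAffine.Point,
      WeierstrassCurve.Affine.Point.map (W' := W) (ringClassField K ι ℓ).subtype.toRatAlgHom y₁ =
        heegnerPointComplexOfConductor Dt (NumberField.discr K) β 1 ∧
      ∑ g ∈ Tp, pointGalHom W (ringClassField K ι ℓ) g d.y + ∑ g ∈ Tm, pointGalHom W (ringClassField K ι ℓ) g d.y =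
        (W.frobeniusTrace ℓ) • ∑ s ∈ d.S, pointGalHom W (ringClassField K ι ℓ) s y₁ := by
  obtain ⟨y₁, hy₁, hsum⟩ := heegner_sum_pow_sigma_eq_frobeniusTrace_zsmul hK hD hH hℓ hinert hℓN d
  refine ⟨y₁, hy₁, ?_⟩
  rw [← Finset.sum_union (heegner_disjoint_fixCoset_flipCoset hθ0 Tp Tm hTp hTm),
    heegner_fixCoset_union_flipCoset_eq hK hD hℓ hinert d hθ2 Tp Tm hTp hTm,
    Finset.sum_image (heegner_injOn_mul_pow hK hD hℓ hinert d), Finset.sum_product, Finset.smul_sum]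
  refine Finset.sum_congr rfl fun s _ ↦ ?_
  have hre : ∑ i ∈ range (ℓ + 1), pointGalHom W (ringClassField K ι ℓ) (s * d.σ ℓ ^ i) d.y =
      pointGalHom W (ringClassField K ι ℓ) s (∑ i ∈ range (ℓ + 1), pointGalHom W (ringClassField K ι ℓ) (d.σ ℓ ^ i) d.y) := by
    rw [map_sum]
    exact Finset.sum_congr rfl fun i _ ↦ by rw [map_mul]; rfl
  rw [hre, hsum, map_zsmul]

/-! ## §2 Isotypy of the genus-character point -/

/-- **An element of `𝒢_ℓ` FIXING `θ` fixes `Y⁺` and `Y⁻`; one MOVING `θ` swaps them.** (Left multiplication by `h` permutes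
`𝒢_ℓ` and multiplies the sign `gθ/θ` by `hθ/θ`.) [cite: SilvermanAEC2009, X.2 Prop. 2.4 (proof)] -/
theorem heegner_smul_signCoset_sum {ℓ : ℕ} (d : KolyvaginHeegnerData Dt β ι ℓ) {θ : ringClassField K ι ℓ}
    (Tp Tm : Finset (ringClassField K ι ℓ ≃ₐ[ℚ] ringClassField K ι ℓ))
    (hTp : ∀ g, g ∈ Tp ↔ g ∈ ringClassGal ι ℓ ∧ g θ = θ) (hTm : ∀ g, g ∈ Tm ↔ g ∈ ringClassGal ι ℓ ∧ g θ = -θ)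
    {h : ringClassField K ι ℓ ≃ₐ[ℚ] ringClassField K ι ℓ} (hh : h ∈ ringClassGal ι ℓ) :
    (h θ = θ →
      pointGalHom W (ringClassField K ι ℓ) h (∑ g ∈ Tp, pointGalHom W (ringClassField K ι ℓ) g d.y) =
        ∑ g ∈ Tp, pointGalHom W (ringClassField K ι ℓ) g d.y ∧
      pointGalHom W (ringClassField K ι ℓ) h (∑ g ∈ Tm, pointGalHom W (ringClassField K ι ℓ) g d.y) =
        ∑ g ∈ Tm, pointGalHom W (ringClassField K ι ℓ) g d.y) ∧
    (h θ = -θ →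
      pointGalHom W (ringClassField K ι ℓ) h (∑ g ∈ Tp, pointGalHom W (ringClassField K ι ℓ) g d.y) =
        ∑ g ∈ Tm, pointGalHom W (ringClassField K ι ℓ) g d.y ∧
      pointGalHom W (ringClassField K ι ℓ) h (∑ g ∈ Tm, pointGalHom W (ringClassField K ι ℓ) g d.y) =
        ∑ g ∈ Tp, pointGalHom W (ringClassField K ι ℓ) g d.y) := by
  -- generic reindexing: `h · Σ_{A} g y = Σ_{B} g y` whenever `g ↦ h g` maps `A` onto `B` bijectively
  have key : ∀ (A B : Finset (ringClassField K ι ℓ ≃ₐ[ℚ] ringClassField K ι ℓ)),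
      (∀ g ∈ A, h * g ∈ B) → (∀ g ∈ B, h⁻¹ * g ∈ A) →
      pointGalHom W (ringClassField K ι ℓ) h (∑ g ∈ A, pointGalHom W (ringClassField K ι ℓ) g d.y) =
        ∑ g ∈ B, pointGalHom W (ringClassField K ι ℓ) g d.y := by
    intro A B hAB hBA
    rw [map_sum]
    have hre : ∀ g ∈ A, pointGalHom W (ringClassField K ι ℓ) h (pointGalHom W (ringClassField K ι ℓ) g d.y) =
        pointGalHom W (ringClassField K ι ℓ) (h * g) d.y := fun g _ ↦ by rw [map_mul]; rfl
    rw [Finset.sum_congr rfl hre]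
    refine Finset.sum_nbij (fun g ↦ h * g) hAB (fun g _ g' _ hgg' ↦ mul_left_cancel hgg') ?_ (fun _ _ ↦ rfl)
    intro g hg
    exact ⟨h⁻¹ * g, Finset.mem_coe.mpr (hBA g (Finset.mem_coe.mp hg)), by simp only; rw [mul_inv_cancel_left]⟩
  have hinv : h⁻¹ ∈ ringClassGal ι ℓ := Subgroup.inv_mem _ hh
  -- `h⁻¹ θ` from `h θ`
  have hinv_fix : h θ = θ → h⁻¹ θ = θ := fun e ↦ by
    conv_lhs => rw [← e]
    exact h.symm_apply_apply θ
  have hinv_flip : h θ = -θ → h⁻¹ θ = -θ := fun e ↦ by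
    have e' : h (-θ) = θ := by rw [map_neg, e, neg_neg]
    conv_lhs => rw [← e']
    rw [show h⁻¹ (h (-θ)) = -θ from h.symm_apply_apply (-θ)]
  refine ⟨fun e ↦ ⟨key Tp Tp ?_ ?_, key Tm Tm ?_ ?_⟩, fun e ↦ ⟨key Tp Tm ?_ ?_, key Tm Tp ?_ ?_⟩⟩
  · intro g hg; rw [hTp] at hg ⊢; exact ⟨Subgroup.mul_mem _ hh hg.1, by rw [AlgEquiv.mul_apply, hg.2, e]⟩
  · intro g hg; rw [hTp] at hg ⊢; exact ⟨Subgroup.mul_mem _ hinv hg.1, by rw [AlgEquiv.mul_apply, hg.2, hinv_fix e]⟩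
  · intro g hg; rw [hTm] at hg ⊢; exact ⟨Subgroup.mul_mem _ hh hg.1, by rw [AlgEquiv.mul_apply, hg.2, map_neg, e]⟩
  · intro g hg; rw [hTm] at hg ⊢
    exact ⟨Subgroup.mul_mem _ hinv hg.1, by rw [AlgEquiv.mul_apply, hg.2, map_neg, hinv_fix e]⟩
  · intro g hg; rw [hTp] at hg; rw [hTm]; exact ⟨Subgroup.mul_mem _ hh hg.1, by rw [AlgEquiv.mul_apply, hg.2, e]⟩
  · intro g hg; rw [hTm] at hg; rw [hTp]
    exact ⟨Subgroup.mul_mem _ hinv hg.1, by rw [AlgEquiv.mul_apply, hg.2, map_neg, hinv_flip e, neg_neg]⟩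
  · intro g hg; rw [hTm] at hg; rw [hTp]
    exact ⟨Subgroup.mul_mem _ hh hg.1, by rw [AlgEquiv.mul_apply, hg.2, map_neg, e, neg_neg]⟩
  · intro g hg; rw [hTp] at hg; rw [hTm]; exact ⟨Subgroup.mul_mem _ hinv hg.1, by rw [AlgEquiv.mul_apply, hg.2, hinv_flip e]⟩

/-- **THE GENUS-CHARACTER HEEGNER POINT IS `χ_ℓ`-ISOTYPIC**: `Y_χ := Y⁺ − Y⁻ = Σ_{g∈𝒢_ℓ} χ_ℓ(g) g·y(ℓ)` is fixed by the `g ∈ 𝒢_ℓ`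
fixing `θ = √ℓ*` and NEGATED by those moving it — `Y_χ ∈ E(K[ℓ])^{χ_ℓ}`, the `χ_ℓ`-part of `E(K(√ℓ*))`, which the twist
isomorphism identifies with `E^{(ℓ*)}(K)`: the Heegner datum of the genus pair `(E^{(ℓ*)}, E^{(d_K ℓ*)})` of the route's thesis
(Gross–Zagier for the genus character `χ_ℓ` of `Gal(K[ℓ]/K)`). [cite: GrossLMS1991, §3 (3.5), §4 (4.1)]
[cite: GrossZagier1986, Thm. I.6.3 (with characters of the class group)] -/
theorem heegner_genusCharacterPoint_isotypic {ℓ : ℕ} (d : KolyvaginHeegnerData Dt β ι ℓ) {θ : ringClassField K ι ℓ}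
    (Tp Tm : Finset (ringClassField K ι ℓ ≃ₐ[ℚ] ringClassField K ι ℓ))
    (hTp : ∀ g, g ∈ Tp ↔ g ∈ ringClassGal ι ℓ ∧ g θ = θ) (hTm : ∀ g, g ∈ Tm ↔ g ∈ ringClassGal ι ℓ ∧ g θ = -θ)
    {h : ringClassField K ι ℓ ≃ₐ[ℚ] ringClassField K ι ℓ} (hh : h ∈ ringClassGal ι ℓ) :
    (h θ = θ → pointGalHom W (ringClassField K ι ℓ) h
        (∑ g ∈ Tp, pointGalHom W (ringClassField K ι ℓ) g d.y - ∑ g ∈ Tm, pointGalHom W (ringClassField K ι ℓ) g d.y) =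
      ∑ g ∈ Tp, pointGalHom W (ringClassField K ι ℓ) g d.y - ∑ g ∈ Tm, pointGalHom W (ringClassField K ι ℓ) g d.y) ∧
    (h θ = -θ → pointGalHom W (ringClassField K ι ℓ) h
        (∑ g ∈ Tp, pointGalHom W (ringClassField K ι ℓ) g d.y - ∑ g ∈ Tm, pointGalHom W (ringClassField K ι ℓ) g d.y) =
      -(∑ g ∈ Tp, pointGalHom W (ringClassField K ι ℓ) g d.y - ∑ g ∈ Tm, pointGalHom W (ringClassField K ι ℓ) g d.y)) := by
  obtain ⟨hfix, hflip⟩ := heegner_smul_signCoset_sum d Tp Tm hTp hTm hh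
  refine ⟨fun e ↦ ?_, fun e ↦ ?_⟩
  · rw [map_sub, (hfix e).1, (hfix e).2]
  · rw [map_sub, (hflip e).1, (hflip e).2, neg_sub]

/-! ## §3 `2·Y⁺ = a_ℓ·y_K′ + Y_χ`: Kolyvagin `2`-primitivity at `ℓ` through the isotypic genus point -/

/-- **`2·Y⁺ = a_ℓ·y_K′ + Y_χ`** — the intrinsic form of the route's identity «`2 D_ℓ ≡ Tr − Y_χ`» (`…GenusIdentity`): with
`heegner_exists_two_zsmul_eq_derivedPoint_iff_genusTrace` (`P(ℓ) ∈ 2E ⟺ Y⁺ ∈ 2E`), Kolyvagin `2`-primitivity at a Kolyvagin prime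
`ℓ` at `2` is decided by `a_ℓ·y_K′ + Y_χ (mod 4E(K[ℓ]))`, `Y_χ` the `χ_ℓ`-isotypic genus point.
[cite: GrossLMS1991, §3 (3.5), Prop. 3.7 (1), §4 (4.1)] -/
theorem heegner_two_zsmul_fixPart_eq [W.IsElliptic] [W.IsGloballyMinimal] (hK : IsImaginaryQuadratic K)
    (hD : NumberField.discr K < -4) (hH : SatisfiesHeegnerHypothesis (W.conductorNorm ℤ) K) {ℓ : ℕ} (hℓ : ℓ.Prime)
    (hinert : (Ideal.span {(ℓ : 𝓞 K)}).IsPrime) (hℓN : ¬ ℓ ∣ W.conductorNorm ℤ) (d : KolyvaginHeegnerData Dt β ι ℓ)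
    {θ : ringClassField K ι ℓ} {q : ℚ} (hθ2 : θ ^ 2 = algebraMap ℚ (ringClassField K ι ℓ) q) (hθ0 : θ ≠ 0)
    (Tp Tm : Finset (ringClassField K ι ℓ ≃ₐ[ℚ] ringClassField K ι ℓ))
    (hTp : ∀ g, g ∈ Tp ↔ g ∈ ringClassGal ι ℓ ∧ g θ = θ) (hTm : ∀ g, g ∈ Tm ↔ g ∈ ringClassGal ι ℓ ∧ g θ = -θ) :
    ∃ y₁ : (W.baseChange (ringClassField K ι ℓ)).toAffine.Point,
      WeierstrassCurve.Affine.Point.map (W' := W) (ringClassField K ι ℓ).subtype.toRatAlgHom y₁ =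
        heegnerPointComplexOfConductor Dt (NumberField.discr K) β 1 ∧
      (2 : ℤ) • ∑ g ∈ Tp, pointGalHom W (ringClassField K ι ℓ) g d.y =
        (W.frobeniusTrace ℓ) • ∑ s ∈ d.S, pointGalHom W (ringClassField K ι ℓ) s y₁ +
          (∑ g ∈ Tp, pointGalHom W (ringClassField K ι ℓ) g d.y - ∑ g ∈ Tm, pointGalHom W (ringClassField K ι ℓ) g d.y) := by
  obtain ⟨y₁, hy₁, hsum⟩ := heegner_fixPart_add_flipPart_eq hK hD hH hℓ hinert hℓN d hθ2 hθ0 Tp Tm hTp hTm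
  refine ⟨y₁, hy₁, ?_⟩
  rw [← hsum, two_smul]
  abel

end Heegner

end Summit.BirchSwinnertonDyer.BirchSwinnertonDyer.Theorems.GenusKoly

end
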